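import Summits.QuantumAdvantage.QuantumAdvantage.Theses.MobiusLadder
import Summits.QuantumAdvantage.QuantumAdvantage.Theorems.MobiusLadderLiouvilleOrthogonalTC0Defs
import Literature.Computability.Complexity.PRelHierarchy
import HarnessLib

/-!
# Crux `MobiusLadder.LiouvilleNotPPoly` (stmt-QuantumAdvantage-1389): objects of the line `SketchIdeator4`
(card `multiplicative-one-time-pad`, crux-ideate r2 k4)

Definitions only (no proofs of stubs) used by the positive-side files of this crux, i.e. by the
registered stubs of the checked skeleton `Cruxes/LiouvilleNotPPoly/Lines/SketchIdeator4.lean` (lead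
`prover-line-stmt-QuantumAdvantage-1389-a1-0`), by its kernel file
`MobiusLadderLiouvilleNotPPolyOneTimePad.lean` and by its composition `LiouvilleNotPPoly_of`:

* `liouvilleLang` — the Liouville language `L_λ = {bin(N) : λ(N) = -1}`, literally the set of the crux
  (`Theses.MobiusLadder.LiouvilleNotPPoly ↔ liouvilleLang ∉ PPoly` holds by `Iff.rfl`);
* `words ℓ`, `errCount L L' ℓ` (number of words of length `ℓ` on which two languages disagree) and the
  refutation target **`RareErrorFamily ε`** (a `P/poly` language agreeing with `L_λ` off a
  `2^{-ℓ^ε}/16` fraction of every large length) — the object of T1 (`X ⟺ ¬ RareErrorFamily ε`);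
* **`padOracle L' n₀`** — the two-query truth table `[bin(N·r) ∈ L'] ≠ [bin(r) ∈ L']` of the
  multiplicative one-time pad `λ(N) = λ(N r) λ(r)` (the `bp`-witness of T1; pairs read through the
  tree's `fstP`/`sndP`, numerals through `bitsToNat`/`encodeNat`);
* `disagree n C` (instances of length `n` a circuit gets wrong, verdict bit `lamBit`), the `1/poly` level
  **`MildAvgHard c`**, the correlation `corr n C` (route convention `sgn true = -1`, digits `bits`) and
  the apex **`LiouvilleOrthogonalPPoly`** (Möbius randomness at polynomial size — the `P/poly` rung of
  the route's ladder whose `AC⁰`/`TC⁰` rungs are items 1394/1393; hypothesis-type, `≥ X`);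
* `prodCorr n k C` — correlation with `λ` on the Kalai product ensemble (object of T2);
* `flipAt p`, `CloseAtRate δ O f` — the adversary and the error-rate notion of the ceiling theorem T1′.

Circuit-side vocabulary (`bits`, `ofBits`, `lamBit`) is REUSED from
`MobiusLadderLiouvilleOrthogonalTC0Defs.lean` (sibling crux 1393), not re-declared.
Pattern: `Theorems/MobiusLadderLiouvilleOrthogonalTC0Defs.lean`.
-/

set_option linter.dupNamespace false -- D-0017: single-problem summit ⇒ `QuantumAdvantage.QuantumAdvantage` by design

noncomputable section

namespace Summit.QuantumAdvantage.QuantumAdvantage.Theorems.LiouvilleNotPPoly.OneTimePad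

open Literature.Computability.Complexity
open Literature.Probability.RandomGraphs.LowDegree (sgn)
open _root_.Computability Filter Finset Polynomial
open Summit.QuantumAdvantage.QuantumAdvantage.Theorems.LiouvilleOrthogonalTC0 (bits ofBits lamBit)

/-! ## Definitions of the line -/

/-- The Liouville language `L_λ = {bin(N) : λ(N) = -1}` (canonical LSB-first numerals), literally the
set the crux speaks about. -/
abbrev liouvilleLang : Language Bool :=
  encodingNatBool.toLanguage {N : ℕ | ArithmeticFunction.liouville N = -1}

/-- The `2^ℓ` words of length `ℓ`. -/
def words (ℓ : ℕ) : Finset (List Bool) := (Finset.univ : Finset (Fin ℓ → Bool)).image List.ofFn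

open Classical in
/-- `errCount L L' ℓ`: the number of words of length `ℓ` on which the languages `L`, `L'` disagree. -/
def errCount (L L' : Language Bool) (ℓ : ℕ) : ℕ :=
  ((words ℓ).filter fun w => ¬ (w ∈ L ↔ w ∈ L')).card

/-- `RareErrorFamily ε`: some `P/poly` language disagrees with `L_λ` on at most a `2^{-ℓ^ε}/16`
fraction of the words of every large length `ℓ` — the refutation target that T1 legitimises. -/
def RareErrorFamily (ε : ℝ) : Prop :=
  ∃ L' ∈ PPoly, ∀ᶠ ℓ : ℕ in atTop,
    (errCount liouvilleLang L' ℓ : ℝ) ≤ (2 : ℝ) ^ ((ℓ : ℝ) - (ℓ : ℝ) ^ ε) / 16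

/-- **The pad oracle** of a language `L'` with length threshold `n₀` — the two-query truth table of the
multiplicative one-time pad. On a pair `w = ⟨x, y⟩` (read through `fstP`/`sndP`): `x` must be a
canonical numeral of length `≥ n₀` (value `N = bitsToNat x`), the coins `y` of length `m` name the
multiplier `r = 2^m + bitsToNat y ∈ [2^m, 2^{m+1})`, and the verdict is
`[bin(N·r) ∈ L'] ≠ [bin(r) ∈ L']` — for an `L'` correct at both words this is `[λ(N r) ≠ λ(r)] = [λ(N) = -1]`
(`λ(N) = λ(N r) λ(r)`): no sign `λ(r)` has to be KNOWN, the oracle is asked for it. -/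
def padOracle (L' : Language Bool) (n₀ : ℕ) : Language Bool :=
  {w | n₀ ≤ (fstP w).length ∧ encodeNat (bitsToNat (fstP w)) = fstP w ∧
    (encodeNat (bitsToNat (fstP w) * (2 ^ (sndP w).length + bitsToNat (sndP w))) ∈ L' ↔
      encodeNat (2 ^ (sndP w).length + bitsToNat (sndP w)) ∉ L')}

/-- The number of length-`n` INSTANCES — codewords of length `n` are exactly the numerals of
`N ∈ [2^{n-1}, 2^n)` — on which the circuit's verdict (accept ↔ "λ(N) = -1", `lamBit`) is wrong. -/
def disagree (n : ℕ) (C : Circuit (Fin n)) : ℕ :=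
  ((Finset.Ico (2 ^ (n - 1)) (2 ^ n)).filter fun N => C.eval (bits n N) ≠ lamBit N).card

/-- **`MildAvgHard c` — the `1/poly` level of the average-case axis.** For every size polynomial,
eventually every `B₂`-circuit of size `≤ p(n)` errs on at least a `n^{-c}` fraction of the `2^{n-1}`
instances of length `n`. Hypothesis-type (`⇒ X`). -/
def MildAvgHard (c : ℕ) : Prop :=
  ∀ p : Polynomial ℕ, ∀ᶠ n : ℕ in atTop, ∀ C : Circuit (Fin n), C.IsOver B2 → C.size ≤ p.eval n →
    (2 : ℝ) ^ (n - 1) ≤ (n : ℝ) ^ c * disagree n C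

/-- The correlation of a circuit with `λ` below `2^n` (the route file's convention, items 1393/1394:
`sgn true = -1`, digits via `Nat.testBit`). -/
def corr (n : ℕ) (C : Circuit (Fin n)) : ℝ :=
  ∑ N ∈ Finset.range (2 ^ n), ((ArithmeticFunction.liouville N : ℤ) : ℝ) * sgn (C.eval (bits n N))

/-- **The apex `C⁺ = LiouvilleOrthogonalPPoly`** — Möbius randomness at polynomial size: for every
polynomial `p` and `ε > 0`, eventually every `B₂`-circuit of size `≤ p(n)` has correlation `≤ ε 2^n`
with `λ` below `2^n`. The `P/poly` rung of the route's correlation ladder (its `AC⁰` rung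
`LiouvilleOrthogonalAC0` = item 1394 is PROVED, its `TC⁰` rung is item 1393). Hypothesis-type, `≥ X`. -/
def LiouvilleOrthogonalPPoly : Prop :=
  ∀ p : Polynomial ℕ, ∀ ε : ℝ, 0 < ε → ∀ᶠ n : ℕ in atTop, ∀ C : Circuit (Fin n), C.IsOver B2 →
    C.size ≤ p.eval n → |corr n C| ≤ ε * (2 : ℝ) ^ n

/-- The correlation of a circuit on `k·n` input bits with `λ` on the **Kalai product ensemble**
`D_{n,k}`: the product of `k` independent uniform instances of length `n` (numbers in `[2^{n-1}, 2^n)`),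
read through its `k·n` low digits; normalised to `[-1, 1]`. -/
def prodCorr (n k : ℕ) (C : Circuit (Fin (k * n))) : ℝ :=
  (∑ v : Fin k → Fin (2 ^ (n - 1)),
      ((ArithmeticFunction.liouville (∏ i, (2 ^ (n - 1) + (v i : ℕ))) : ℤ) : ℝ) *
        sgn (C.eval (bits (k * n) (∏ i, (2 ^ (n - 1) + (v i : ℕ)))))) /
    ((2 : ℝ) ^ (n - 1)) ^ k

/-- `flipAt p N := λ(N)·(-1)^{v_p(N)}` — the completely multiplicative `±1` function that agrees with `λ`
at every prime except `p`, where it is `+1` (the adversary of T1′). -/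
def flipAt (p : ℕ) (N : ℕ) : ℤ := ArithmeticFunction.liouville N * (-1) ^ padicValNat p N

/-- `CloseAtRate δ O f`: the oracle `O` disagrees with `f` on at most `δ·X + 1` of the arguments below
every `X` (a density-`δ` error rate, uniformly in the cut-off). -/
def CloseAtRate (δ : ℝ) (O f : ℕ → ℤ) : Prop :=
  ∀ X : ℕ, (((Finset.range X).filter fun N => O N ≠ f N).card : ℝ) ≤ δ * X + 1

/-! ## Anchor -/

/-- The crux, by name, is `L_λ ∉ P/poly` for THIS `liouvilleLang` (registered anchor of the Defs file;
`Iff.rfl`). -/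
theorem crux_iff : Theses.MobiusLadder.LiouvilleNotPPoly ↔ liouvilleLang ∉ PPoly := Iff.rfl

end Summit.QuantumAdvantage.QuantumAdvantage.Theorems.LiouvilleNotPPoly.OneTimePad

end
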